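import Mathlib
import Summits.NavierStokesRegularity.NavierStokesRegularity.Theorems.EulerZoomLiouvillePowerGaugeEulerLiouvilleRigidFrameCommonAxis
import Summits.NavierStokesRegularity.NavierStokesRegularity.Theorems.EulerZoomLiouvillePowerGaugeEulerLiouvilleRigidFrameBodyFrame
import Summits.NavierStokesRegularity.NavierStokesRegularity.Theorems.EulerZoomLiouvillePowerGaugeEulerLiouvilleRigidFrameKilling
import Summits.NavierStokesRegularity.NavierStokesRegularity.Theorems.EulerZoomLiouvillePowerGaugeEulerLiouvilleScrewInvariantKill
import Summits.NavierStokesRegularity.NavierStokesRegularity.Theorems.EulerZoomLiouvillePowerGaugeEulerLiouvilleRigidFrameSteady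
import Summits.NavierStokesRegularity.NavierStokesRegularity.Theorems.EulerZoomLiouvillePowerGaugeEulerLiouvilleGalileanFrameSteady
import Literature.Analysis.FluidPDE.WeakGradientIBP
import HarnessLib

/-!
# E(3)-STEADY PAST MEMBERS ARE TRIVIAL — rigid-frame-steady members with ESCAPING centre and TIME-DEPENDENT rotation
# (crux `EulerZoomLiouville.PowerGaugeEulerLiouville` = stmt-NavierStokesRegularity-19832; the un-confined twin of F1g; width seat ns-ezl-w3 g6)

Route №10 `EulerZoomLiouville` (NavierStokesRegularity), crux E.  A member `(u, p, H)` of Seregin's power-gauged ancient Euler class that is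
STEADY IN A RIGIDLY MOVING FRAME below some `T₁ ≤ 0`,

> `u(τ, y) = R(τ) U(R(τ)⁻¹(y − ξ(τ)))` for `τ < T₁`, `R : ℝ → O(3)` and `ξ : ℝ → ℝ³` of class `C¹`, `U` an arbitrary profile,

VANISHES a.e. on the slab (`RigidFrame.ae_eq_zero_of_gauge_of_pastRigidFrameSteady`; `0 < ρ ≤ 1/2`).  NO confinement of the centre `ξ` is assumed
— this is the «E(3)-steady, ESCAPING» residue left open by F1g `RigidFrame.ae_eq_zero_of_gauge_of_pastRigidFrameSteady_confined` (ns-ezl-w3 g5).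

PROOF (the chain of ns-ezl-w3 g4/g5 + the common-zero lemma of this generation).  (1) A good slice gives `U ∈ L¹_loc`, the A-gauge growth
`∫_{B_R}|U|² ≤ C R^{1−2ρ}` and `|U|² ∈ L¹_loc`; the profile is weakly divergence free (`RigidFrame.rigidProfile_integral_inner_gradient_eq_zero`).
(2) BODY VELOCITIES `κ_τ = (A(τ), v(τ)) = (R⁻¹R′, R⁻¹ξ′)`; by `RigidFrame.bodyFrame_twoTime` the Lie derivative of `U` along every DIFFERENCE
`κ_{τ₁} − κ_{τ₂}` is weakly a gradient, and by linearity the same holds on their span `W` (`RigidFrame.killingPairing_span`).  (3) DICHOTOMY.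
(a) Some `κ = (B, b) ∈ W` has NO zero (`b ∉ range B`): `RigidFrame.killing_invariance` makes `U(· + y₀)` invariant under a GENUINE screw / translation
(`b′ ≠ 0`) and `RigidFrame.screwInvariant_ae_eq_zero` kills it (`m = 1 − 2ρ < 1`), so every slice below `T₁` has zero energy and
`PastSymmetric.ae_eq_zero_of_gauge_of_pastSlicesZero` closes.  (b) Every `κ ∈ W` has a zero: `RigidFrame.exists_common_zero` (this generation's
linear algebra) gives ONE point `p₀` with `b = B p₀` for all `(B, b) ∈ W`, i.e. `v(τ) − A(τ)p₀ ≡ c₀`; then the lab point `ζ = ξ − R p₀` has velocity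
`R c₀` of CONSTANT NORM, so `‖ξ(τ)‖ ≤ K(1 + |τ|)` (mean value inequality) and F1g (`β = 1`, `1·(1−ρ) < 1`) kills the member.  No re-framing, no
`SO(3)`-radial lemma, no Lie-group closure is needed.

* `RigidFrame.ae_eq_zero_of_gauge_of_pastRigidFrameSteady` — THE STRATUM (no background; the background version is the companion file
  `…RigidFrameNoBackground`);
* `RigidFrame.rigidFrameSteadyEscaping` — binder form for the line `galilean_frames` (owner's `Sig.stub_rigidFrameSteady…`, to be typed).

WHAT THIS IS NOT: not NS regularity, not the crux E — the `E(3)`-steady symmetry stratum of the crux CLASS 19832 (MODEL lattice; E/NS strata) is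
EMPTY; DENT on the skeleton's three open stubs = 0; `--supports` stmt-19832; 19832 OPEN. [folklore; MajdaBertozzi2002 Prop. 1.1 p. 12 (Euclidean
invariance of the Euler equations)]
-/

noncomputable section

-- flat `Theorems/<Route><Decl>…` files of one crux share the namespace of the crux (tree convention: `Summit.<S>.<S>.…`)
set_option linter.dupNamespace false

open MeasureTheory Set Filter Topology Metric Function TopologicalSpace InnerProductSpace
open scoped ENNReal NNReal RealInnerProductSpace ContDiff

namespace Summit.NavierStokesRegularity.NavierStokesRegularity.Theorems.PowerGaugeEulerLiouville

namespace RigidFrame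

open Literature.Analysis Literature.Analysis.FunctionSpaces Literature.Analysis.FluidPDE
open Summit.NavierStokesRegularity.NavierStokesRegularity.Theorems.PowerGaugeEulerLiouville.GalileanFrames

/-! ### The Killing pairing `κ ↦ ∫⟪U, DΦ(κ.1 z + κ.2) − κ.1 Φ⟫` is linear and vanishes on spans -/

/-- The Killing pairing integrand is integrable: `U ∈ L¹_loc`, `Φ` a test field. [folklore] -/
theorem integrable_killingPairing {U : EuclideanSpace ℝ (Fin 3) → EuclideanSpace ℝ (Fin 3)} (hU : LocallyIntegrable U volume)
    {Φ : EuclideanSpace ℝ (Fin 3) → EuclideanSpace ℝ (Fin 3)} (hΦ : IsTestFunctionOn (⊤ : Opens (EuclideanSpace ℝ (Fin 3))) Φ)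
    (B : EuclideanSpace ℝ (Fin 3) →L[ℝ] EuclideanSpace ℝ (Fin 3)) (b : EuclideanSpace ℝ (Fin 3)) :
    Integrable (fun z => ⟪U z, (fderiv ℝ Φ z) (B z + b) - B (Φ z)⟫) volume := by
  have i1 : Integrable (fun z => ⟪U z, (fderiv ℝ Φ z) (B z + b)⟫) volume := by
    refine integrable_inner_of_locallyIntegrable_of_hasCompactSupport hU
      ((hΦ.contDiff.continuous_fderiv (by simp)).clm_apply (B.continuous.add continuous_const)) ?_
    refine (hΦ.hasCompactSupport.fderiv (𝕜 := ℝ)).mono fun x hx => ?_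
    by_contra h0
    exact hx (by simp only [Function.notMem_support.1 h0, zero_apply])
  have i2 : Integrable (fun z => ⟪U z, B (Φ z)⟫) volume :=
    integrable_inner_of_locallyIntegrable_of_hasCompactSupport hU (B.continuous.comp hΦ.contDiff.continuous)
      (hΦ.hasCompactSupport.comp_left (map_zero _))
  have e : (fun z => ⟪U z, (fderiv ℝ Φ z) (B z + b) - B (Φ z)⟫) =
      fun z => ⟪U z, (fderiv ℝ Φ z) (B z + b)⟫ - ⟪U z, B (Φ z)⟫ := by
    funext z; rw [inner_sub_right]
  rw [e]; exact i1.sub i2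

/-- **The Killing pairing vanishes on the span of a set on which it vanishes** (linearity of `κ ↦ ∫⟪U, DΦ(κ.1 z + κ.2) − κ.1 Φ(z)⟫`). [folklore] -/
theorem killingPairing_span {U : EuclideanSpace ℝ (Fin 3) → EuclideanSpace ℝ (Fin 3)} (hU : LocallyIntegrable U volume)
    {Φ : EuclideanSpace ℝ (Fin 3) → EuclideanSpace ℝ (Fin 3)} (hΦ : IsTestFunctionOn (⊤ : Opens (EuclideanSpace ℝ (Fin 3))) Φ)
    {S : Set ((EuclideanSpace ℝ (Fin 3) →L[ℝ] EuclideanSpace ℝ (Fin 3)) × EuclideanSpace ℝ (Fin 3))}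
    (hS : ∀ κ ∈ S, ∫ z, ⟪U z, (fderiv ℝ Φ z) (κ.1 z + κ.2) - κ.1 (Φ z)⟫ = 0)
    {κ : (EuclideanSpace ℝ (Fin 3) →L[ℝ] EuclideanSpace ℝ (Fin 3)) × EuclideanSpace ℝ (Fin 3)} (hκ : κ ∈ Submodule.span ℝ S) :
    ∫ z, ⟪U z, (fderiv ℝ Φ z) (κ.1 z + κ.2) - κ.1 (Φ z)⟫ = 0 := by
  induction hκ using Submodule.span_induction with
  | mem x hx => exact hS x hx
  | zero => simp
  | add x y _ _ hx hy =>
      have e : (fun z => ⟪U z, (fderiv ℝ Φ z) ((x + y).1 z + (x + y).2) - (x + y).1 (Φ z)⟫) =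
          fun z => ⟪U z, (fderiv ℝ Φ z) (x.1 z + x.2) - x.1 (Φ z)⟫ + ⟪U z, (fderiv ℝ Φ z) (y.1 z + y.2) - y.1 (Φ z)⟫ := by
        funext z
        rw [← inner_add_right]
        congr 1
        simp only [Prod.fst_add, Prod.snd_add, add_apply, map_add]
        abel
      rw [e, integral_add (integrable_killingPairing hU hΦ _ _) (integrable_killingPairing hU hΦ _ _), hx, hy, add_zero]
  | smul a x _ hx =>
      have e : (fun z => ⟪U z, (fderiv ℝ Φ z) ((a • x).1 z + (a • x).2) - (a • x).1 (Φ z)⟫) =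
          fun z => a * ⟪U z, (fderiv ℝ Φ z) (x.1 z + x.2) - x.1 (Φ z)⟫ := by
        funext z
        rw [← real_inner_smul_right]
        congr 1
        simp only [Prod.smul_fst, Prod.smul_snd, smul_apply, map_add, map_smul, smul_sub, smul_add]
      rw [e, integral_const_mul, hx, mul_zero]

/-! ### The stratum -/

/-- **E(3)-STEADY PAST MEMBERS ARE TRIVIAL** (`0 < ρ ≤ 1/2`; no confinement of the centre).  Let `(u, p)` be a suitable weak Euler pair on
`(−∞,0) × ℝ³` with weak spatial gradient `H` in Seregin's class `a^{2ρ}A(a) + a^{ρ}E(a) + a^{2ρ}D(a) ≤ c` (all `a > 0`), and suppose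
`u(τ, ·) = R(τ) U(R(τ)⁻¹(· − ξ(τ)))` for all `τ < T₁ ≤ 0` with an arbitrary profile `U`, a `C¹` path `R` of linear isometries of `ℝ³` and a `C¹`
centre path `ξ` (NO growth condition).  Then `u = 0` a.e. on the slab.  DICHOTOMY on the span `W` of the body-velocity differences: a genuine screw
/ translation in `W` kills the profile (`killing_invariance` + `screwInvariant_ae_eq_zero`); otherwise `exists_common_zero` gives `p₀` with
`v − A p₀` constant, the centre grows at most linearly, and the confined theorem (`β = 1`) applies. [folklore; MajdaBertozzi2002 Prop. 1.1 p. 12] -/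
theorem ae_eq_zero_of_gauge_of_pastRigidFrameSteady {ρ : ℝ} (hρ : 0 < ρ) (hρ2 : ρ ≤ 1 / 2)
    {u : ℝ → EuclideanSpace ℝ (Fin 3) → EuclideanSpace ℝ (Fin 3)} {p : ℝ → EuclideanSpace ℝ (Fin 3) → ℝ}
    {H : ℝ → EuclideanSpace ℝ (Fin 3) → EuclideanSpace ℝ (Fin 3) →L[ℝ] EuclideanSpace ℝ (Fin 3)} {c : ℝ≥0} {T₁ : ℝ}
    {U : EuclideanSpace ℝ (Fin 3) → EuclideanSpace ℝ (Fin 3)}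
    {R : ℝ → EuclideanSpace ℝ (Fin 3) ≃ₗᵢ[ℝ] EuclideanSpace ℝ (Fin 3)} {ξ : ℝ → EuclideanSpace ℝ (Fin 3)}
    (hsw : IsSuitableWeakSolutionOn (slab (EuclideanSpace ℝ (Fin 3)) (Iio 0) isOpen_Iio) 0 0 u p)
    (hH : HasWeakSpatialGradientOn (slab (EuclideanSpace ℝ (Fin 3)) (Iio 0) isOpen_Iio) u H)
    (hc : ∀ a : ℝ, 0 < a → ENNReal.ofReal (a ^ (2 * ρ)) * cknA a (0 : ℝ × EuclideanSpace ℝ (Fin 3)) u +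
        ENNReal.ofReal (a ^ ρ) * cknE a (0 : ℝ × EuclideanSpace ℝ (Fin 3)) H +
        ENNReal.ofReal (a ^ (2 * ρ)) * cknD a (0 : ℝ × EuclideanSpace ℝ (Fin 3)) p ≤ (c : ℝ≥0∞))
    (hT₁ : T₁ ≤ 0)
    (hR : ContDiff ℝ 1 (fun τ => (R τ : EuclideanSpace ℝ (Fin 3) →L[ℝ] EuclideanSpace ℝ (Fin 3)))) (hξ : ContDiff ℝ 1 ξ)
    (hu : ∀ τ : ℝ, τ < T₁ → u τ = fun y => R τ (U ((R τ).symm (y - ξ τ)))) :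
    uncurry u =ᵐ[volume.restrict (Iio (0 : ℝ) ×ˢ (univ : Set (EuclideanSpace ℝ (Fin 3))))] 0 := by
  have hρ1 : ρ < 1 := by linarith
  have hA : ∀ a : ℝ, 0 < a → ENNReal.ofReal (a ^ (2 * ρ)) * cknA a (0 : ℝ × EuclideanSpace ℝ (Fin 3)) u ≤ (c : ℝ≥0∞) :=
    fun a ha => le_trans (le_trans le_self_add le_self_add) (hc a ha)
  have hsol : IsDistributionalNSSolutionOn (slab (EuclideanSpace ℝ (Fin 3)) (Iio 0) isOpen_Iio) 0 0 u p := hsw.distributional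
  have hξc : Continuous ξ := hξ.continuous
  -- ### the frame as paths of continuous linear maps
  set Rc : ℝ → EuclideanSpace ℝ (Fin 3) →L[ℝ] EuclideanSpace ℝ (Fin 3) := fun τ => (R τ : EuclideanSpace ℝ (Fin 3) →L[ℝ] EuclideanSpace ℝ (Fin 3))
    with hRc
  set Rinv : ℝ → EuclideanSpace ℝ (Fin 3) →L[ℝ] EuclideanSpace ℝ (Fin 3) :=
    fun τ => ((R τ).symm : EuclideanSpace ℝ (Fin 3) →L[ℝ] EuclideanSpace ℝ (Fin 3)) with hRinv
  have hRcd : ContDiff ℝ 1 Rc := hR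
  have hRcc : Continuous Rc := hR.continuous
  have hRi : ∀ τ w, ‖Rc τ w‖ = ‖w‖ := fun τ w => (R τ).norm_map w
  have h1 : ∀ τ x, Rc τ (Rinv τ x) = x := fun τ x => (R τ).apply_symm_apply x
  have h2 : ∀ τ w, Rinv τ (Rc τ w) = w := fun τ w => (R τ).symm_apply_apply w
  have hRinvc : Continuous Rinv := by
    have e : Rinv = fun τ => ContinuousLinearMap.adjoint (Rc τ) := by
      funext τ; rw [hRc]; dsimp only; rw [(R τ).adjoint_eq_symm]
    rw [e]
    exact (ContinuousLinearMap.adjoint :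
      (EuclideanSpace ℝ (Fin 3) →L[ℝ] EuclideanSpace ℝ (Fin 3)) ≃ₗᵢ⋆[ℝ]
        (EuclideanSpace ℝ (Fin 3) →L[ℝ] EuclideanSpace ℝ (Fin 3))).continuous.comp hRcc
  have hu' : ∀ τ : ℝ, τ < T₁ → u τ = fun x => Rc τ (U (Rinv τ (x - ξ τ))) := fun τ hτ => by
    rw [hu τ hτ]
    funext x
    simp only [hRc, hRinv, LinearIsometryEquiv.coe_coe'']
  -- ### (1) a good slice: `U ∈ L¹_loc`, measurable, growth, `|U|² ∈ L¹_loc`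
  have hne : (ae (volume.restrict (Iio T₁))).NeBot := by
    rw [ae_neBot, Ne, Measure.restrict_eq_zero, Real.volume_Iio]; exact ENNReal.top_ne_zero
  obtain ⟨τ₀, hτ₀W, hτ₀T⟩ := ((FrameSteady.ae_hasWeakFDerivOn_slice_past hH hT₁).and (ae_restrict_mem measurableSet_Iio)).exists
  have hτ₀T : τ₀ < T₁ := hτ₀T
  have hUeq : U = fun z => Rinv τ₀ (u τ₀ (Rc τ₀ z + ξ τ₀)) := by
    funext z
    rw [hu' τ₀ hτ₀T]
    dsimp only
    rw [add_sub_cancel_right, h2, h2]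
  have hslice_li : LocallyIntegrable (u τ₀) volume :=
    locallyIntegrableOn_univ.1 (by simpa only [Opens.coe_top] using hτ₀W.locallyIntegrableOn)
  -- the affine isometry `z ↦ R z + ξ` as a homeomorphism preserving the volume
  have haff_mp : MeasurePreserving (fun z : EuclideanSpace ℝ (Fin 3) => Rc τ₀ z + ξ τ₀) volume volume :=
    (measurePreserving_add_right volume (ξ τ₀)).comp (R τ₀).measurePreserving
  have hUl : LocallyIntegrable U volume := by
    set e : EuclideanSpace ℝ (Fin 3) ≃ₜ EuclideanSpace ℝ (Fin 3) := (R τ₀).toHomeomorph.trans (Homeomorph.addRight (ξ τ₀)) with he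
    have hecoe : ⇑e = fun z => Rc τ₀ z + ξ τ₀ := rfl
    have hmap : Measure.map e (volume : Measure (EuclideanSpace ℝ (Fin 3))) = volume := by rw [hecoe]; exact haff_mp.map_eq
    have h3 : LocallyIntegrable (fun z => u τ₀ (Rc τ₀ z + ξ τ₀)) volume := by
      have := (locallyIntegrable_map_homeomorph e (f := u τ₀) (μ := volume)).1 (by rw [hmap]; exact hslice_li)
      rw [hecoe] at this; exact this
    rw [hUeq]
    refine (locallyIntegrable_iff).2 fun K hK => ?_
    exact (Rinv τ₀).integrable_comp ((locallyIntegrable_iff).1 h3 K hK)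
  have hUm : AEStronglyMeasurable U volume := hUl.aestronglyMeasurable
  have hnorm : ∀ z, ‖U z‖ = ‖u τ₀ (R τ₀ z + ξ τ₀)‖ := by
    intro z
    rw [hUeq]
    simp only [hRinv, hRc, LinearIsometryEquiv.coe_coe'', LinearIsometryEquiv.norm_map]
  -- growth at large radii
  set R₀ : ℝ := 2 - T₁ + |τ₀| + ‖ξ τ₀‖ with hR₀
  have hR₀1 : 1 ≤ R₀ := by rw [hR₀]; linarith [abs_nonneg τ₀, norm_nonneg (ξ τ₀)]
  have hgrowR₀ : ∀ L : ℝ, R₀ ≤ L → ∫⁻ z in ball (0 : EuclideanSpace ℝ (Fin 3)) L, ‖U z‖ₑ ^ 2 ≤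
      (2 * (c : ℝ≥0∞)) * ENNReal.ofReal (L ^ (1 - 2 * ρ)) := by
    intro L hL
    have hL1 : 1 ≤ L := hR₀1.trans hL
    have hL0 : 0 < L := by linarith
    have h2L : 0 < 2 * L := by linarith
    have hτ₀I : τ₀ ∈ Ioo (-((2 * L) ^ 2)) 0 := by
      refine ⟨?_, lt_of_lt_of_le hτ₀T hT₁⟩
      have : |τ₀| ≤ L := by rw [hR₀] at hL; linarith [norm_nonneg (ξ τ₀)]
      nlinarith [neg_abs_le τ₀, abs_nonneg τ₀]
    have hAs := Backward.lintegral_ball_le_of_gaugeA h2L (hA (2 * L) h2L) hτ₀I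
    have hξL : ‖ξ τ₀‖ ≤ L := by rw [hR₀] at hL; linarith [abs_nonneg τ₀]
    calc ∫⁻ z in ball (0 : EuclideanSpace ℝ (Fin 3)) L, ‖U z‖ₑ ^ 2
        = ∫⁻ z in ball (0 : EuclideanSpace ℝ (Fin 3)) L, ‖u τ₀ (R τ₀ z + ξ τ₀)‖ₑ ^ 2 := by
          refine lintegral_congr_ae (Eventually.of_forall fun z => ?_)
          dsimp only
          rw [← ofReal_norm, ← ofReal_norm, hnorm]
      _ = ∫⁻ z in ball (0 : EuclideanSpace ℝ (Fin 3)) L, ‖u τ₀ (z + ξ τ₀)‖ₑ ^ 2 :=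
          RotatingFrame.setLIntegral_ball_comp_isometry (R τ₀) (fun z => ‖u τ₀ (z + ξ τ₀)‖ₑ ^ 2) L
      _ ≤ ∫⁻ z in ball (0 : EuclideanSpace ℝ (Fin 3)) (2 * L), ‖u τ₀ z‖ₑ ^ 2 :=
          FrameSteady.setLIntegral_ball_translate_le (fun z => ‖u τ₀ z‖ₑ ^ 2) hξL
      _ ≤ ENNReal.ofReal ((c : ℝ) * (2 * L) ^ (1 - 2 * ρ)) := hAs
      _ ≤ (2 * (c : ℝ≥0∞)) * ENNReal.ofReal (L ^ (1 - 2 * ρ)) := by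
          have h2 : (2 : ℝ) ^ (1 - 2 * ρ) ≤ 2 ^ (1 : ℝ) := Real.rpow_le_rpow_of_exponent_le one_le_two (by linarith)
          rw [Real.rpow_one] at h2
          have h3 : (c : ℝ) * (2 * L) ^ (1 - 2 * ρ) ≤ 2 * (c : ℝ) * L ^ (1 - 2 * ρ) := by
            rw [Real.mul_rpow zero_le_two hL0.le]
            have hLe := Real.rpow_nonneg hL0.le (1 - 2 * ρ)
            calc (c : ℝ) * ((2 : ℝ) ^ (1 - 2 * ρ) * L ^ (1 - 2 * ρ)) = (2 : ℝ) ^ (1 - 2 * ρ) * ((c : ℝ) * L ^ (1 - 2 * ρ)) := by ring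
              _ ≤ 2 * ((c : ℝ) * L ^ (1 - 2 * ρ)) := mul_le_mul_of_nonneg_right h2 (mul_nonneg c.coe_nonneg hLe)
              _ = 2 * (c : ℝ) * L ^ (1 - 2 * ρ) := by ring
          calc ENNReal.ofReal ((c : ℝ) * (2 * L) ^ (1 - 2 * ρ)) ≤ ENNReal.ofReal (2 * (c : ℝ) * L ^ (1 - 2 * ρ)) :=
                ENNReal.ofReal_le_ofReal h3
            _ = (2 * (c : ℝ≥0∞)) * ENNReal.ofReal (L ^ (1 - 2 * ρ)) := by
                rw [ENNReal.ofReal_mul (by positivity), ENNReal.ofReal_mul zero_le_two, ENNReal.ofReal_ofNat,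
                  ENNReal.ofReal_coe_nnreal]
  have hgrow1 := Past.growth_ge_one_of_growth_ge (f := fun z => ‖U z‖ₑ ^ 2) hR₀1 (by linarith : (0 : ℝ) ≤ 1 - 2 * ρ) hgrowR₀
  set Cg : ℝ≥0∞ := 2 * (c : ℝ≥0∞) * ENNReal.ofReal (R₀ ^ (1 - 2 * ρ)) with hCg
  have hCgtop : Cg ≠ ⊤ := ENNReal.mul_ne_top (ENNReal.mul_ne_top ENNReal.ofNat_ne_top ENNReal.coe_ne_top) ENNReal.ofReal_ne_top
  have hgrowC : ∀ L : ℝ, 1 ≤ L → ∫⁻ z in ball (0 : EuclideanSpace ℝ (Fin 3)) L, ‖U z‖ₑ ^ 2 ≤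
      ENNReal.ofReal (Cg.toReal * L ^ (1 - 2 * ρ)) := by
    intro L hL
    rw [ENNReal.ofReal_mul ENNReal.toReal_nonneg, ENNReal.ofReal_toReal hCgtop]
    exact hgrow1 L hL
  have hU2 : LocallyIntegrable (fun z => ‖U z‖ ^ 2) volume := by
    refine EnergySaturation.locallyIntegrable_norm_sq_of_growth_loc (ρ := ρ) hUm (c := Cg.toNNReal) fun L hL => ?_
    rw [ENNReal.coe_toNNReal hCgtop]
    exact hgrow1 L hL
  -- ### (2) the profile is weakly divergence free
  have hdivU : ∀ φ : EuclideanSpace ℝ (Fin 3) → ℝ, ContDiff ℝ (⊤ : ℕ∞) φ → HasCompactSupport φ → ∫ z, ⟪U z, gradient φ z⟫ = 0 :=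
    fun φ hφ hφc => rigidProfile_integral_inner_gradient_eq_zero hsol hT₁ hu' hUl hξc hRcc hRinvc hRi h1 h2 hφ hφc
  -- ### (3) body velocities and the span of their differences
  set Av : ℝ → EuclideanSpace ℝ (Fin 3) →L[ℝ] EuclideanSpace ℝ (Fin 3) := fun τ => (Rinv τ).comp (deriv Rc τ) with hAv
  set vv : ℝ → EuclideanSpace ℝ (Fin 3) := fun τ => Rinv τ (deriv ξ τ) with hvv
  set S : Set ((EuclideanSpace ℝ (Fin 3) →L[ℝ] EuclideanSpace ℝ (Fin 3)) × EuclideanSpace ℝ (Fin 3)) :=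
    {κ | ∃ τ₁ τ₂ : ℝ, τ₁ < T₁ ∧ τ₂ < T₁ ∧ κ = (Av τ₁ - Av τ₂, vv τ₁ - vv τ₂)} with hS
  set W : Submodule ℝ ((EuclideanSpace ℝ (Fin 3) →L[ℝ] EuclideanSpace ℝ (Fin 3)) × EuclideanSpace ℝ (Fin 3)) :=
    Submodule.span ℝ S with hW
  -- skewness of the body angular velocities, hence of every `κ.1`, `κ ∈ W`
  have hAskew : ∀ τ x, ⟪Av τ x, x⟫ = 0 := by
    intro τ x
    have h := inner_bodyAngular_skew (R := Rc) (Rinv := Rinv) (hRcd.differentiable (by simp)) hRi h1 τ x x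
    simp only [hAv, ContinuousLinearMap.comp_apply]
    have h' : ⟪Rinv τ (deriv Rc τ x), x⟫ = ⟪x, Rinv τ (deriv Rc τ x)⟫ := real_inner_comm _ _
    linarith
  have hskewW : ∀ κ ∈ W, ∀ x : EuclideanSpace ℝ (Fin 3), ⟪κ.1 x, x⟫ = 0 := by
    intro κ hκ
    induction hκ using Submodule.span_induction with
    | mem κ hκ =>
        obtain ⟨τ₁, τ₂, -, -, rfl⟩ := hκ
        intro x
        show ⟪(Av τ₁ - Av τ₂) x, x⟫ = 0
        rw [sub_apply, inner_sub_left, hAskew, hAskew, sub_self]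
    | zero => intro x; simp
    | add x y _ _ hx hy => intro z; simp only [Prod.fst_add, add_apply, inner_add_left, hx, hy, add_zero]
    | smul a x _ hx => intro z; simp only [Prod.smul_fst, smul_apply, real_inner_smul_left, hx, mul_zero]
  -- the Killing pairing vanishes on `S` (two-time identity), hence on `W`
  have hshearW : ∀ κ ∈ W, ∀ Φ : EuclideanSpace ℝ (Fin 3) → EuclideanSpace ℝ (Fin 3), ContDiff ℝ (⊤ : ℕ∞) Φ → HasCompactSupport Φ →
      (∀ z, LinearMap.trace ℝ (EuclideanSpace ℝ (Fin 3))
        ((fderiv ℝ Φ z : EuclideanSpace ℝ (Fin 3) →L[ℝ] EuclideanSpace ℝ (Fin 3)) :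
          EuclideanSpace ℝ (Fin 3) →ₗ[ℝ] EuclideanSpace ℝ (Fin 3)) = 0) →
      ∫ z, ⟪U z, (fderiv ℝ Φ z) (κ.1 z + κ.2) - κ.1 (Φ z)⟫ = 0 := by
    intro κ hκ Φ hΦ hΦc htr
    have hΦ' : IsTestFunctionOn (⊤ : Opens (EuclideanSpace ℝ (Fin 3))) Φ := ⟨hΦ, hΦc, by simp⟩
    refine killingPairing_span hUl hΦ' (fun κ' hκ' => ?_) hκ
    obtain ⟨τ₁, τ₂, hτ₁, hτ₂, rfl⟩ := hκ'
    have key := bodyFrame_twoTime hsol hT₁ hu' hUm hUl hU2 hξ hRcd hRinvc hRi h1 h2 hΦ' htr hτ₁ hτ₂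
    have e : (fun z => ⟪U z, (fderiv ℝ Φ z) ((Av τ₁ - Av τ₂, vv τ₁ - vv τ₂).1 z + (Av τ₁ - Av τ₂, vv τ₁ - vv τ₂).2) -
        (Av τ₁ - Av τ₂, vv τ₁ - vv τ₂).1 (Φ z)⟫) =
        fun w => ⟪U w, (fderiv ℝ Φ w) ((Rinv τ₁ (deriv Rc τ₁ w) - Rinv τ₂ (deriv Rc τ₂ w)) +
          (Rinv τ₁ (deriv ξ τ₁) - Rinv τ₂ (deriv ξ τ₂))) - (Rinv τ₁ (deriv Rc τ₁ (Φ w)) - Rinv τ₂ (deriv Rc τ₂ (Φ w)))⟫ := by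
      funext w
      simp only [hAv, hvv, sub_apply, ContinuousLinearMap.comp_apply]
    rw [e]
    exact key
  -- ### (4) THE DICHOTOMY
  by_cases hz : ∀ κ ∈ W, ∃ q : EuclideanSpace ℝ (Fin 3), κ.2 = κ.1 q
  · -- ## (b) every difference has a zero ⇒ a COMMON zero `p₀` ⇒ the centre grows at most linearly ⇒ the confined theorem
    obtain ⟨p₀, hp₀⟩ := exists_common_zero W hskewW hz
    set τs : ℝ := T₁ - 1 with hτs
    have hτsT : τs < T₁ := by rw [hτs]; linarith
    set c₀ : EuclideanSpace ℝ (Fin 3) := vv τs - Av τs p₀ with hc₀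
    have hconst : ∀ τ : ℝ, τ < T₁ → vv τ - Av τ p₀ = c₀ := by
      intro τ hτ
      have hmem : (Av τ - Av τs, vv τ - vv τs) ∈ W := Submodule.subset_span ⟨τ, τs, hτ, hτsT, rfl⟩
      have h := hp₀ _ hmem
      simp only [sub_apply] at h
      rw [hc₀]
      -- `h : vv τ - vv τs = Av τ p₀ - Av τs p₀`
      have h' : vv τ - vv τs = Av τ p₀ - Av τs p₀ := h
      exact sub_eq_sub_iff_sub_eq_sub.2 h'
    -- the lab point `ζ = ξ − R p₀` moves with speed `‖c₀‖`
    set ζ : ℝ → EuclideanSpace ℝ (Fin 3) := fun s => ξ s - Rc s p₀ with hζ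
    have hζd : ∀ s, HasDerivAt ζ (deriv ξ s - deriv Rc s p₀) s := by
      intro s
      have ha : HasDerivAt (fun t : ℝ => Rc t p₀) (deriv Rc s p₀) s := by
        have h := ((hRcd.differentiable (by simp)) s).hasDerivAt.clm_apply (hasDerivAt_const s p₀); simpa using h
      exact ((hξ.differentiable (by simp)) s).hasDerivAt.sub ha
    have hζn : ∀ s, s < T₁ → ‖deriv ζ s‖ = ‖c₀‖ := by
      intro s hs
      rw [(hζd s).deriv]
      have e1 : deriv ξ s - deriv Rc s p₀ = Rc s (vv s - Av s p₀) := by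
        simp only [hvv, hAv, ContinuousLinearMap.comp_apply, map_sub, h1]
      rw [e1, hRi, hconst s hs]
    have hmv : ∀ τ : ℝ, τ < T₁ → ‖ζ τ - ζ τs‖ ≤ ‖c₀‖ * ‖τ - τs‖ := by
      intro τ hτ
      exact (convex_Iio T₁).norm_image_sub_le_of_norm_deriv_le (fun s _ => (hζd s).differentiableAt)
        (fun s hs => (hζn s hs).le) hτsT hτ
    -- linear growth of the centre
    set K : ℝ := ‖ζ τs‖ + ‖p₀‖ + ‖c₀‖ * (1 + |τs|) with hK
    have hK0 : 0 ≤ K := by rw [hK]; positivity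
    have hξb : ∀ τ : ℝ, τ < T₁ → ‖ξ τ‖ ≤ K * (1 + |τ|) ^ (1 : ℝ) := by
      intro τ hτ
      rw [Real.rpow_one]
      have e1 : ξ τ = (ζ τ - ζ τs) + ζ τs + Rc τ p₀ := by simp only [hζ]; abel
      have hn : ‖ξ τ‖ ≤ ‖ζ τ - ζ τs‖ + ‖ζ τs‖ + ‖Rc τ p₀‖ := by
        rw [e1]; exact norm_add₃_le
      rw [hRi] at hn
      have h3 := hmv τ hτ
      rw [Real.norm_eq_abs] at h3
      have h4 : |τ - τs| ≤ |τ| + |τs| := abs_sub _ _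
      rw [hK]
      nlinarith [norm_nonneg (ζ τs), norm_nonneg p₀, norm_nonneg c₀, abs_nonneg τ, abs_nonneg τs,
        mul_nonneg (norm_nonneg c₀) (abs_nonneg τ), mul_nonneg (norm_nonneg c₀) (mul_nonneg (abs_nonneg τ) (abs_nonneg τs))]
    have hu0 : ∀ τ : ℝ, τ < T₁ → u τ = fun y => R τ (U ((R τ).symm (y - ξ τ))) + (fun _ : ℝ => (0 : EuclideanSpace ℝ (Fin 3))) τ := by
      intro τ hτ; rw [hu τ hτ]; funext y; simp
    exact ae_eq_zero_of_gauge_of_pastRigidFrameSteady_confined hρ hρ1 hsw hH hc hT₁ hu0 hK0 (β := 1) (by linarith) hξb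
  · -- ## (a) a genuine screw / translation in `W`: the profile vanishes
    push Not at hz
    obtain ⟨κ, hκW, hκnz⟩ := hz
    obtain ⟨y₀, b', hb', hb, hinv⟩ := killing_invariance ρ hρ (U := U) (B := κ.1) (b := κ.2) (C := Cg.toReal)
      (hskewW κ hκW) hUl hgrowC hdivU (hshearW κ hκW)
    have hb'0 : b' ≠ 0 := by
      intro h0
      apply hκnz (-y₀)
      rw [hb, h0, zero_sub, map_neg]
    -- the recentred profile is screw invariant with sub-volume growth, hence zero
    set U' : EuclideanSpace ℝ (Fin 3) → EuclideanSpace ℝ (Fin 3) := fun z => U (z + y₀) with hU'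
    have hU'm : AEStronglyMeasurable U' volume :=
      hUm.comp_quasiMeasurePreserving (measurePreserving_add_right volume y₀).quasiMeasurePreserving
    have hgrow' := growth_comp_add hgrowC y₀
    have hU'0 : U' =ᵐ[volume] 0 :=
      screwInvariant_ae_eq_zero (U := U') (hskewW κ hκW) hb'0 (by linarith : 1 - 2 * ρ < 1) hU'm hgrow' hinv
    have hU0 : U =ᵐ[volume] 0 := by
      have h := (measurePreserving_add_right volume (-y₀)).quasiMeasurePreserving.ae_eq hU'0
      have e : (U' ∘ fun z => z + -y₀) = U := by funext z; simp [hU']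
      rw [e] at h
      exact h
    -- every slice below `T₁` has zero energy
    have hzero : ∀ᵐ τ ∂(volume.restrict (Iio T₁)), ∫⁻ x, ‖u τ x‖ₑ ^ 2 = 0 := by
      filter_upwards [ae_restrict_mem measurableSet_Iio] with τ hτ
      have hq := ((R τ).symm.measurePreserving.comp (measurePreserving_sub_right volume (ξ τ))).quasiMeasurePreserving.ae_eq hU0
      have hs : (fun x => ‖u τ x‖ₑ ^ 2) =ᵐ[volume] fun _ => 0 := by
        filter_upwards [hq] with x hx
        simp only [Function.comp_apply, Pi.zero_apply] at hx
        rw [hu τ hτ]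
        simp only [hx, map_zero, enorm_zero, ne_eq, OfNat.ofNat_ne_zero, not_false_eq_true, zero_pow]
      rw [lintegral_congr_ae hs, lintegral_zero]
    exact PastSymmetric.ae_eq_zero_of_gauge_of_pastSlicesZero hρ.le hsw hH hc hzero

/-- **BINDER FORM for the line `galilean_frames`** (shape of the owner's rigid-frame stubs, with the line's reducible `InClass` / `VanishesAE`
unfolded; no background — the background version is the companion file `…RigidFrameNoBackground`): a rigid-frame-steady past member of the class
with `C¹` rotation and centre paths — confined or ESCAPING — is trivial. [folklore; MajdaBertozzi2002 Prop. 1.1 p. 12] -/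
theorem rigidFrameSteadyEscaping :
    ∀ ρ : ℝ, 0 < ρ → ρ ≤ 1 / 2 →
      ∀ (u : ℝ → EuclideanSpace ℝ (Fin 3) → EuclideanSpace ℝ (Fin 3)) (p : ℝ → EuclideanSpace ℝ (Fin 3) → ℝ)
        (H : ℝ → EuclideanSpace ℝ (Fin 3) → EuclideanSpace ℝ (Fin 3) →L[ℝ] EuclideanSpace ℝ (Fin 3)) (c : ℝ≥0),
      (IsSuitableWeakSolutionOn (slab (EuclideanSpace ℝ (Fin 3)) (Set.Iio 0) isOpen_Iio) 0 0 u p ∧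
        HasWeakSpatialGradientOn (slab (EuclideanSpace ℝ (Fin 3)) (Set.Iio 0) isOpen_Iio) u H ∧
        (∀ a : ℝ, 0 < a →
          ENNReal.ofReal (a ^ (2 * ρ)) * cknA a (0 : ℝ × EuclideanSpace ℝ (Fin 3)) u +
              ENNReal.ofReal (a ^ ρ) * cknE a (0 : ℝ × EuclideanSpace ℝ (Fin 3)) H +
            ENNReal.ofReal (a ^ (2 * ρ)) * cknD a (0 : ℝ × EuclideanSpace ℝ (Fin 3)) p ≤ (c : ℝ≥0∞))) →
      ∀ (T₁ : ℝ) (U : EuclideanSpace ℝ (Fin 3) → EuclideanSpace ℝ (Fin 3))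
        (R : ℝ → EuclideanSpace ℝ (Fin 3) ≃ₗᵢ[ℝ] EuclideanSpace ℝ (Fin 3)) (ξ : ℝ → EuclideanSpace ℝ (Fin 3)),
        T₁ ≤ 0 → ContDiff ℝ 1 (fun τ => (R τ : EuclideanSpace ℝ (Fin 3) →L[ℝ] EuclideanSpace ℝ (Fin 3))) → ContDiff ℝ 1 ξ →
        (∀ τ : ℝ, τ < T₁ → u τ = fun y => R τ (U ((R τ).symm (y - ξ τ)))) →
        Function.uncurry u =ᵐ[volume.restrict (Set.Iio (0 : ℝ) ×ˢ (Set.univ : Set (EuclideanSpace ℝ (Fin 3))))] 0 :=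
  fun _ hρ hρ2 _ _ _ _ h _ _ _ _ hT₁ hR hξ hu => ae_eq_zero_of_gauge_of_pastRigidFrameSteady hρ hρ2 h.1 h.2.1 h.2.2 hT₁ hR hξ hu

end RigidFrame

end Summit.NavierStokesRegularity.NavierStokesRegularity.Theorems.PowerGaugeEulerLiouville

end
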